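import Summits.QuantumFields.BalabanUV.T4Continuum.Support.GradientRowSumTransport
import Literature.MathematicalPhysics.QuantumFieldTheory.Balaban1983to89.B5Prop12Entries110

/-!
# G-an2-4 ∕ (CONV-C), INTERFACE REQUEST (B5-1115-TABLE), item (E2): [B5] (1.110) SECOND ENTRY «|(∇GJ)(x)| ≤ O(1)e^{−δ₀|y−y′|}|J|»
# for `G = Δ_1⁻¹ = (DeltaA n M 1)⁻¹` AT `U = 1`, `a = 1`, ON EVERY CUBIC UNIT TORUS, UNIFORMLY IN THE SPACING — KERNEL-PROVED
# FROM THE TREE; and the general reduction «per-block row sums ⇒ the (1.110) sup entry» behind the named statement `Entry110Grad`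

G-an2-4 formalisation swarm `b2b-balaban-gan24-formalise-*`, leaf prover 04 (gen 46), crux team (2) under the coordinator ruling
«YM REDIRECT» (e34b3e0c).  WHY THIS FILE — the road-P2 crux prover's **INTERFACE REQUEST G-an2-4: (B5-1115-TABLE)** (unit
`b2b-balaban-gan24-p2` gen 28, `HOME/INBOX.md` 2026-08-21T05:44Z, journal `CLAIMS.log` l.27856) asks, for `G := (DeltaA n M a)⁻¹` at
`U = 1`, for «(E2) `∀ x ∈ B(y), supp J ⊆ B(y′): |(∇_ν G J)(x)| ≤ C·e^{−δ|y−y′|_∞}·|J|`», constants depending on `d`, `a` only,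
uniform in `n = L^k` and in the torus.  Leaf 01 (gen 53) typed it as the named statement
`B5Prop12Entries110.Entry110Grad d a` (p250927; quantified over EVERY torus `M`).  THIS FILE gives the first kernel content toward
it, by bookkeeping over two landed chains:
 * the NE3 prover lineage's `Support/SliceFlatGradient.cubeSum_rowDiff_gFlat_le` (t4-ne3-p1 gen 15, p203576): the block row sums of
   the row-differenced `U = 1` propagator with exponential block-distance decay, uniform in the spacing, on the NE3 carrier
   `(ℤ/N·L^k)^{d+1}` (ONE period for all directions — CUBIC tori);
 * the NE2 swarm's `Support/GradientRowSumTransport.block_row_sum_fdiff_inv_le` (t4-ne2-formalise-leaf-05 gen 6): the same bound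
   transported to pv15's carrier `Tor (fine n M) × Fin (d+1)` and to `∇_ν = fdiff (fine n M) n ν`, `Δ_1⁻¹ = (DeltaA n M 1)⁻¹`
   (its §5 packages only the exponentially WEIGHTED row sums; the per-block form §3 is what (1.110) consumes).

## Contents (no `def`, no `def … : Prop`, no `sorry`; every input imported BY NAME, nothing restated)
* §1 `torusSupNorm_rep_toT_sub_rep_toT` — `|rep ȳ − rep ȳ′|_{T₁,∞} = |y − y′|_{T₁,∞}` (periodicity of the torus sup-distance).
* §2 **`norm_mulVec_bpt_le_of_block_row_sum`** (ANY torus `M`, ANY matrix `K` on `Tor (fine n M) × Fin (d+1)`): a per-block row bound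
  `Σ_{x′ : blockOf x′ = y′} ‖K(i,x′)‖ ≤ B₁·e^{−δ·|blockOf(i) − y′|_{T₁,∞}}` gives the (1.110)-shape sup entry
  `‖(K J)(n·y + r, μ)‖ ≤ B₁·e^{−δ·|y − y′|_{T₁,∞}}·B` for `supp J ⊆ B(y′)`, `|J| ≤ B` — the one step between a kernel row statement and
  the printed localized sup norm (1.108).
* §3 **`entry110Grad_of_block_row_sum`** (ANY `a`): a per-block row bound for `∇_ν·(DeltaA n M a)⁻¹` valid for EVERY torus `M` and every
  `n` IMPLIES the named statement `Entry110Grad d a` — so the named Prop follows in three lines the day a RECTANGULAR-torus supplier lands.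
* §4 `block_row_sum_fdiff_inv_le_cubic` — the NE3 ∕ NE2 per-block bound packaged for every spacing `n ≥ 1` and every CUBIC unit torus
  `Π_μ ℤ/N₀` (witness `(k,N,L,j) = (1,N₀,n,1)` of the NE3 parameters, the `subst` pattern of `weighted_row_sum_fdiff_inv_le_cubic`).
* §5 END **`entry110Grad_one_cubic`**: the BODY of `Entry110Grad d 1` VERBATIM at `M := fun _ => N₀` — there are `δ₀, C > 0` (functions
  of `d`: NE3's constants) such that for every `n ≥ 1`, every `N₀ ≥ 1`, every direction `ν`, all `y, y′ ∈ ℤ^{d+1}`, every `J` supported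
  in the unit cube `B(y′)` with `|J| ≤ B`, every site `x = n·y + r` of `B(y)` and every component `μ`,
  `‖(∇_ν (Δ_1⁻¹ J))_μ(x)‖ ≤ C·e^{−δ₀·|y − y′|_{T₁,∞}}·B`.

HONEST SCOPE.  (i) `a = 1`, `U = 1` only.  (ii) CUBIC unit tori only: the named Prop `Entry110Grad d 1` quantifies over every torus
`M : Fin (d+1) → ℕ` and is NOT discharged here — its rectangular case needs a rectangular-torus version of NE3's free heat-kernel chain or
a covering ∕ periodisation bridge for `DeltaA⁻¹`, neither of which is in the tree (located, not claimed); §3 records exactly what is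
missing.  (iii) The THIRD entry `G∇*` (column sums of `∇G`, not NE3's row statement) and the FOURTH entry `ΔG` are untouched; so are the
Hölder entries (1.111)–(1.117).  (iv) Unit cubes `B` in place of the printed doubled cubes `Δ̃` (as in the landed first entry
`B5Prop12Entries110.entry110G_one`).  (v) Constants are NE3's existential `(B₁, δ)(d)`; nothing printed is asserted — [B5]
`Balaban1984PropagatorsI` p. 35 (1.110) is a TEXT LOCATION; the analysis is t4-ne3-p1's (heat-kernel free gradient + resolvent identity)
and pv15's (block resummation), the transport t4-ne2-formalise-leaf-05's.  NOT (CONV-C), NEVER «G-an2-4 closed», NOT NE2 ∕ NE3, NOT D1,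
NOT BetaPertH, NOT continuum, NOT Clay; not in print — our bookkeeping.  ABSOLUTE RULE of the cell kept («No internally-minted statement
may enter as a cited fact …»): every input is a kernel-proved tree theorem used BY NAME.  HONEST DEPENDENCY: continuum YM on T⁴ ⇐
BetaPertH ∧ nine spine estimates (0/9 proved); BetaPertH ⇐ (D1) ∧ (D4) ∧ CAP+tail; G-an2-4 gates asym, D1 and NE2/3/4.
-/

noncomputable section

open scoped BigOperators ComplexConjugate Matrix
open Finset

namespace Summit.QuantumFields.BalabanUV.Beta.GAN24.Entry110GradCubic

open Literature.MathematicalPhysics.QuantumFieldTheory.Balaban1983to89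
open Literature.MathematicalPhysics.QuantumFieldTheory.Balaban1983to89.TreeLengthTorus (TPt)
open B5Prop11Plancherel (Tor fine fdiff)
open B5Block118 (bpt)
open B5Blocks16 (blockOf blockOf_bpt)
open B6LowerBound2153Torus (toT rep)
open B5DeltaA169 (DeltaA)
open B4TorusKernel.MultiPeriod (torusSupNorm torusSupNorm_nonneg torusSupNorm_translate translate translate_apply)
open B5Hk163TorusHolderRate (exists_eq_translate_rep)
open B5Prop12Entries110 (Entry110Grad)
open Summit.QuantumFields.BalabanUV.T4Continuum
open SliceTorusBlocks SliceTorusTower SliceFlatPropagator SliceFlatGradient GradientRowSumTransport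

variable {d : ℕ}

/-! ## §1 The torus sup-distance of box representatives -/

/-- `|rep ȳ − rep ȳ′|_{T₁,∞} = |y − y′|_{T₁,∞}`: the torus sup-distance between the box representatives of the classes of two integer
points is the torus sup-distance of their difference (both differ by a period vector; `torusSupNorm_translate`). [folklore] -/
theorem torusSupNorm_rep_toT_sub_rep_toT (M : Fin (d + 1) → ℕ) [∀ μ, NeZero (M μ)] (y y' : Fin (d + 1) → ℤ) :
    torusSupNorm M (rep M (toT M y) - rep M (toT M y')) = torusSupNorm M (y - y') := by
  obtain ⟨m, hm⟩ := exists_eq_translate_rep M y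
  obtain ⟨m', hm'⟩ := exists_eq_translate_rep M y'
  have h : y - y' = translate M (rep M (toT M y) - rep M (toT M y')) (m - m') := by
    conv_lhs => rw [hm, hm']
    funext i
    simp only [Pi.sub_apply, translate_apply]
    ring
  rw [h, torusSupNorm_translate]

/-! ## §2 Per-block row sums ⇒ the (1.110)-shape localized sup entry (any torus, any matrix) -/

/-- **PER-BLOCK ROW SUMS ⇒ THE (1.110) SUP ENTRY** (any torus `M`, any spacing `n⁻¹`, any matrix `K` on Bałaban's fine torus with
`d+1` components): if every row `i` of `K` has block row sums `Σ_{x′ : blockOf x′ = y′} ‖K(i,x′)‖ ≤ B₁·e^{−δ·|rep(blockOf i) − rep y′|_{T₁,∞}}`,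
then for every `J` supported in the unit cube `B(y′)` with `|J| ≤ B` (the sup norm (1.108)), every site `x = n·y + r` of `B(y)` and
every component `μ`: `‖(K J)(x, μ)‖ ≤ B₁·e^{−δ·|y − y′|_{T₁,∞}}·B`. [folklore] -/
theorem norm_mulVec_bpt_le_of_block_row_sum (n : ℕ) [NeZero n] (M : Fin (d + 1) → ℕ) [∀ μ, NeZero (M μ)]
    (K : Matrix (Tor (fine n M) × Fin (d + 1)) (Tor (fine n M) × Fin (d + 1)) ℂ) {B₁ δ : ℝ}
    (hK : ∀ (i : Tor (fine n M) × Fin (d + 1)) (y' : Tor M),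
      ∑ x' : Tor (fine n M) × Fin (d + 1), (if blockOf n M x'.1 = y' then ‖K i x'‖ else 0)
        ≤ B₁ * Real.exp (-(δ * torusSupNorm M (rep M (blockOf n M i.1) - rep M y'))))
    (y y' : Fin (d + 1) → ℤ) (J : Tor (fine n M) × Fin (d + 1) → ℂ) {B : ℝ} (hJB : ∀ j, ‖J j‖ ≤ B)
    (hsupp : ∀ j, J j ≠ 0 → ∃ r' : Fin (d + 1) → Fin n, j.1 = bpt n M (toT M y') r')
    (r : Fin (d + 1) → Fin n) (μ : Fin (d + 1)) :
    ‖(K *ᵥ J) (bpt n M (toT M y) r, μ)‖ ≤ B₁ * Real.exp (-(δ * torusSupNorm M (y - y'))) * B := by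
  set i₀ : Tor (fine n M) × Fin (d + 1) := (bpt n M (toT M y) r, μ) with hi₀
  have hB0 : 0 ≤ B := (norm_nonneg _).trans (hJB i₀)
  -- each summand of `(K J)(i₀)` is bounded by the block indicator of `B(y′)` times `B`
  have hterm : ∀ j : Tor (fine n M) × Fin (d + 1),
      ‖K i₀ j * J j‖ ≤ (if blockOf n M j.1 = toT M y' then ‖K i₀ j‖ else 0) * B := by
    intro j
    by_cases hJ : J j = 0
    · rw [hJ, mul_zero, norm_zero]
      exact mul_nonneg (by split_ifs <;> simp) hB0
    · obtain ⟨r', hr'⟩ := hsupp j hJ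
      have hb : blockOf n M j.1 = toT M y' := by rw [hr', blockOf_bpt]
      rw [if_pos hb, norm_mul]
      exact mul_le_mul_of_nonneg_left (hJB j) (norm_nonneg _)
  have hblk : blockOf n M i₀.1 = toT M y := blockOf_bpt n M (toT M y) r
  calc ‖(K *ᵥ J) i₀‖ = ‖∑ j, K i₀ j * J j‖ := by simp only [Matrix.mulVec, dotProduct]
    _ ≤ ∑ j, ‖K i₀ j * J j‖ := norm_sum_le _ _
    _ ≤ ∑ j, (if blockOf n M j.1 = toT M y' then ‖K i₀ j‖ else 0) * B := Finset.sum_le_sum fun j _ => hterm j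
    _ = (∑ j, (if blockOf n M j.1 = toT M y' then ‖K i₀ j‖ else 0)) * B := by rw [Finset.sum_mul]
    _ ≤ B₁ * Real.exp (-(δ * torusSupNorm M (rep M (blockOf n M i₀.1) - rep M (toT M y')))) * B :=
        mul_le_mul_of_nonneg_right (hK i₀ (toT M y')) hB0
    _ = B₁ * Real.exp (-(δ * torusSupNorm M (y - y'))) * B := by
        rw [hblk, torusSupNorm_rep_toT_sub_rep_toT]

/-! ## §3 What the named statement `Entry110Grad d a` needs: a per-block row bound for `∇_ν·Δ_a⁻¹` on EVERY torus -/

/-- **`Entry110Grad d a` FROM A PER-BLOCK ROW BOUND ON EVERY TORUS**: if there are `B₁, δ > 0` such that for every spacing `n⁻¹`,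
EVERY torus `M`, every direction `ν`, every row `i` and every block `y′`,
`Σ_{x′ : blockOf x′ = y′} ‖(∇_ν·Δ_a⁻¹)(i,x′)‖ ≤ B₁·e^{−δ·|rep(blockOf i) − rep y′|_{T₁,∞}}`, then the named second entry of (1.110),
`B5Prop12Entries110.Entry110Grad d a`, holds (`∇_ν (G J) = (∇_ν·G) J`, §2).  The tree supplies the hypothesis for CUBIC tori at `a = 1`
(§4); the rectangular case is what remains for the named Prop. [folklore] -/
theorem entry110Grad_of_block_row_sum (a : ℝ)
    (h : ∃ B₁ δ : ℝ, 0 < B₁ ∧ 0 < δ ∧ ∀ (n : ℕ) (M : Fin (d + 1) → ℕ) [NeZero n] [∀ μ, NeZero (M μ)],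
      ∀ (ν : Fin (d + 1)) (i : Tor (fine n M) × Fin (d + 1)) (y' : Tor M),
        ∑ x' : Tor (fine n M) × Fin (d + 1),
            (if blockOf n M x'.1 = y' then ‖(fdiff (fine n M) (n : ℂ) ν * (DeltaA n M a)⁻¹) i x'‖ else 0)
          ≤ B₁ * Real.exp (-(δ * torusSupNorm M (rep M (blockOf n M i.1) - rep M y')))) :
    Entry110Grad d a := by
  obtain ⟨B₁, δ, hB, hδ, hblock⟩ := h
  refine ⟨δ, B₁, hδ, hB, ?_⟩
  intro n M _ _ _hn ν y y' J B hJB hsupp r μ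
  rw [Matrix.mulVec_mulVec]
  exact norm_mulVec_bpt_le_of_block_row_sum n M _ (fun i y₁ => hblock n M ν i y₁) y y' J hJB hsupp r μ

/-! ## §4 The per-block bound for every spacing and every CUBIC unit torus (NE3 ∕ NE2-leaf-05, packaged) -/

/-- **(1.110), SECOND ENTRY `∇G`, `U = 1`, `a = 1`, PER-BLOCK ROW SUMS, n-UNIFORM, PACKAGED ON CUBIC TORI**: there are `B, δ > 0`
depending on `d` only (NE3's constants of `SliceFlatGradient.cubeSum_rowDiff_gFlat_le`) such that for EVERY number of sites per block
side `n ≥ 1`, EVERY cubic unit torus `Π_μ ℤ/N₀` (`N₀ ≥ 1`), every direction `ν`, every row `i` and every block `y′`,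
`Σ_{x′ : blockOf x′ = y′} ‖(∇_ν·Δ_1⁻¹)(i,x′)‖ ≤ B·e^{−δ·|rep(blockOf i) − rep y′|_{T₁,∞}}` — `GradientRowSumTransport.block_row_sum_fdiff_inv_le`
at the NE3 parameters `(k,N,L,j) = (1,N₀,n,1)`. [folklore] -/
theorem block_row_sum_fdiff_inv_le_cubic :
    ∃ B δ : ℝ, 0 < B ∧ 0 < δ ∧ ∀ (n N₀ : ℕ) [NeZero n] [NeZero N₀] (ν : Fin (d + 1))
      (i : Tor (fine n (fun _ : Fin (d + 1) => N₀)) × Fin (d + 1)) (y' : Tor (fun _ : Fin (d + 1) => N₀)),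
        ∑ x' : Tor (fine n (fun _ : Fin (d + 1) => N₀)) × Fin (d + 1),
            (if blockOf n (fun _ : Fin (d + 1) => N₀) x'.1 = y' then
              ‖(fdiff (fine n (fun _ : Fin (d + 1) => N₀)) (n : ℂ) ν * (DeltaA n (fun _ : Fin (d + 1) => N₀) 1)⁻¹) i x'‖
             else 0)
          ≤ B * Real.exp (-(δ * torusSupNorm (fun _ : Fin (d + 1) => N₀)
              (rep (fun _ : Fin (d + 1) => N₀) (blockOf n (fun _ : Fin (d + 1) => N₀) i.1)
                - rep (fun _ : Fin (d + 1) => N₀) y'))) := by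
  obtain ⟨B₁, δ, hB, hδ, hrow⟩ := cubeSum_rowDiff_gFlat_le d
  refine ⟨B₁, δ, hB, hδ, fun n N₀ _ _ ν i y' => ?_⟩
  have key : ∀ (n' : ℕ) (M' : Fin (d + 1) → ℕ), n' = side 1 n 1 → M' = Mlev d 1 N₀ n 1 →
      ∀ [NeZero n'] [∀ μ, NeZero (M' μ)] (i : Tor (fine n' M') × Fin (d + 1)) (y' : Tor M'),
        ∑ x' : Tor (fine n' M') × Fin (d + 1),
            (if blockOf n' M' x'.1 = y' then ‖(fdiff (fine n' M') (n' : ℂ) ν * (DeltaA n' M' 1)⁻¹) i x'‖ else 0)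
          ≤ B₁ * Real.exp (-(δ * torusSupNorm M' (rep M' (blockOf n' M' i.1) - rep M' y'))) := by
    intro n' M' hn' hM'
    subst hn' hM'
    intro _ _ i y'
    exact block_row_sum_fdiff_inv_le d 1 N₀ n hδ.le hrow le_rfl ν i y'
  exact key n (fun _ => N₀) (by simp [side]) (by funext μ; simp [Mlev, levM]) i y'

/-! ## §5 END: (1.110), second entry, `a = 1`, every spacing, every CUBIC unit torus -/

/-- **(E2) ∕ [B5] (1.110), SECOND ENTRY, AT `a = 1` ON EVERY CUBIC UNIT TORUS, UNIFORMLY IN THE SPACING** — the body of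
`B5Prop12Entries110.Entry110Grad d 1` VERBATIM at `M := fun _ => N₀`: there are `δ₀ > 0`, `C > 0` (depending on `d` only) such that
for every `n ≥ 1`, every `N₀ ≥ 1`, every direction `ν`, all `y, y′ ∈ ℤ^{d+1}`, every field `J` supported in the unit cube `B(y′)` with
`|J| ≤ B`, every site `x = n·y + r` of `B(y)` and every component `μ`:
`‖(∇_ν (Δ_1⁻¹ J))_μ(x)‖ ≤ C·e^{−δ₀·|y − y′|_{T₁,∞}}·B`, `∇_ν = fdiff (fine n M) n ν`, `Δ_1⁻¹ = (DeltaA n M 1)⁻¹`.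
(Location of the printed text: [B5] `Balaban1984PropagatorsI` Prop. 1.2 (1.110) p. 35, second entry; the typed inequality — unit cubes,
cubic tori, `a = 1`, NE3's constants — is ours, not a quotation.) [folklore] -/
theorem entry110Grad_one_cubic :
    ∃ δ₀ C : ℝ, 0 < δ₀ ∧ 0 < C ∧
      ∀ (n N₀ : ℕ) [NeZero n] [NeZero N₀], 1 ≤ n →
        ∀ (ν : Fin (d + 1)) (y y' : Fin (d + 1) → ℤ) (J : Tor (fine n (fun _ : Fin (d + 1) => N₀)) × Fin (d + 1) → ℂ) (B : ℝ),
          (∀ j, ‖J j‖ ≤ B) →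
          (∀ j, J j ≠ 0 → ∃ r' : Fin (d + 1) → Fin n,
              j.1 = bpt n (fun _ : Fin (d + 1) => N₀) (toT (fun _ : Fin (d + 1) => N₀) y') r') →
          ∀ (r : Fin (d + 1) → Fin n) (μ : Fin (d + 1)),
            ‖(fdiff (fine n (fun _ : Fin (d + 1) => N₀)) (n : ℂ) ν *ᵥ
                ((DeltaA n (fun _ : Fin (d + 1) => N₀) 1)⁻¹ *ᵥ J)) (bpt n (fun _ : Fin (d + 1) => N₀) (toT (fun _ : Fin (d + 1) => N₀) y) r, μ)‖
              ≤ C * Real.exp (-(δ₀ * torusSupNorm (fun _ : Fin (d + 1) => N₀) (y - y'))) * B := by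
  obtain ⟨B₁, δ, hB, hδ, hblock⟩ := block_row_sum_fdiff_inv_le_cubic (d := d)
  refine ⟨δ, B₁, hδ, hB, ?_⟩
  intro n N₀ _ _ _hn ν y y' J B hJB hsupp r μ
  rw [Matrix.mulVec_mulVec]
  exact norm_mulVec_bpt_le_of_block_row_sum n (fun _ : Fin (d + 1) => N₀) _ (fun i y₁ => hblock n N₀ ν i y₁)
    y y' J hJB hsupp r μ

/-- SHAPE CERTIFICATE: the END is the body of the named `Entry110Grad d 1` SPECIALISED to cubic tori — the named Prop (all tori)
implies it by instantiation `M := fun _ => N₀`, term for term. [folklore] -/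
example (h : Entry110Grad d 1) :
    ∃ δ₀ C : ℝ, 0 < δ₀ ∧ 0 < C ∧
      ∀ (n N₀ : ℕ) [NeZero n] [NeZero N₀], 1 ≤ n →
        ∀ (ν : Fin (d + 1)) (y y' : Fin (d + 1) → ℤ) (J : Tor (fine n (fun _ : Fin (d + 1) => N₀)) × Fin (d + 1) → ℂ) (B : ℝ),
          (∀ j, ‖J j‖ ≤ B) →
          (∀ j, J j ≠ 0 → ∃ r' : Fin (d + 1) → Fin n,
              j.1 = bpt n (fun _ : Fin (d + 1) => N₀) (toT (fun _ : Fin (d + 1) => N₀) y') r') →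
          ∀ (r : Fin (d + 1) → Fin n) (μ : Fin (d + 1)),
            ‖(fdiff (fine n (fun _ : Fin (d + 1) => N₀)) (n : ℂ) ν *ᵥ
                ((DeltaA n (fun _ : Fin (d + 1) => N₀) 1)⁻¹ *ᵥ J)) (bpt n (fun _ : Fin (d + 1) => N₀) (toT (fun _ : Fin (d + 1) => N₀) y) r, μ)‖
              ≤ C * Real.exp (-(δ₀ * torusSupNorm (fun _ : Fin (d + 1) => N₀) (y - y'))) * B := by
  obtain ⟨δ₀, C, hδ₀, hC, h⟩ := h
  exact ⟨δ₀, C, hδ₀, hC, fun n N₀ _ _ hn => h n (fun _ => N₀) hn⟩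

end Summit.QuantumFields.BalabanUV.Beta.GAN24.Entry110GradCubic

end
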